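import Mathlib
import HarnessLib
import Summits.AnomalousDissipation.AnomalousDissipation.Theses.NeutralTaylorWaves
import Literature.Analysis.FunctionSpaces.TorusFluidGlueProofs

/-!
# Negative lemmas for crux `NeutralTaylorWaves.NonresonantSelection` (stmt-AnomalousDissipation-16294):
# test vectors in the bordered a-priori bound

Two kernel-checked facts about the last clause of the route target `NonresonantTaylorWaves` (the
BORDERED A-PRIORI BOUND `‖v‖₂² + b² ≤ M²(‖w·∇v + v·∇w − νΔv + ∇r − c∂₃v − b∂₃w‖₂² + ⟨v,∂₃w⟩²)` over
smooth divergence-free mean-zero `v`, smooth `r`, real `b`), found in the refuter's crux attack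
(refuter-rattack-stmt-AnomalousDissipation-16294-0, 2026-08-17):

* `bordered_one_le` / `bordered_false_of_planar` — the border test `(v, r, b) = (0, 0, 1)` gives
  `1 ≤ M² ∫‖∂₃w‖²`; an `x₃`-invariant base never carries the bound (witnesses of the target are
  genuinely three-dimensional, `‖∂₃w‖₂ ≥ 1/M`).
* `bordered_false_without_meanZero` — dropping the mean-zero restriction on the test field makes the
  clause FALSE at every smooth base, drift, viscosity and constant: the Galilean triple `(e₃, 0, 1)`
  is an exact kernel vector (`e₃·∇w − ∂₃w = 0`, `∫⟪e₃, ∂₃w⟫ = 0`). Any proof of the crux must use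
  the mean-zero test class (the boost/drift degeneracy behind `CorrelationEnergyUnboundedNeg_refuted`).

Helpers are `private` copies of standard zero/constant-field identities of the torus calculus. [folklore]
-/

set_option linter.dupNamespace false

noncomputable section

namespace Summit.AnomalousDissipation.AnomalousDissipation.Theorems.NonresonantSelection.Negative

open MeasureTheory
open Literature.Analysis.FunctionSpaces


/-- Partial derivatives of a constant field vanish. [folklore] -/
private theorem partialDeriv_const_field' (e : (EuclideanSpace ℝ (Fin 3))) (i : Fin 3) (x : (UnitAddTorus (Fin 3))) :
    Torus.partialDeriv i (fun _ : (UnitAddTorus (Fin 3)) => e) x = 0 := by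
  simp [Torus.partialDeriv, Torus.lineDeriv]

/-- Partial derivatives of the zero scalar vanish. [folklore] -/
private theorem partialDeriv_zero_scalar' (i : Fin 3) (x : (UnitAddTorus (Fin 3))) :
    Torus.partialDeriv i (fun _ : (UnitAddTorus (Fin 3)) => (0 : ℝ)) x = 0 := by
  simp [Torus.partialDeriv, Torus.lineDeriv]

/-- Constant fields are divergence free. [folklore] -/
private theorem isDivFree_const_field' (e : (EuclideanSpace ℝ (Fin 3))) : Torus.IsDivFree (fun _ : (UnitAddTorus (Fin 3)) => e) := by
  intro x
  simp only [Torus.divergence]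
  exact Finset.sum_eq_zero fun i _ => by simp [Torus.partialDeriv, Torus.lineDeriv]

/-- The zero field has zero mean. [folklore] -/
private theorem hasZeroMean_zero_field' : Torus.HasZeroMean (fun _ : (UnitAddTorus (Fin 3)) => (0 : (EuclideanSpace ℝ (Fin 3)))) := by
  simp [Torus.HasZeroMean]

/-- Convecting a constant field gives zero. [folklore] -/
private theorem convect_const_right' (w : (UnitAddTorus (Fin 3)) → (EuclideanSpace ℝ (Fin 3))) (e : (EuclideanSpace ℝ (Fin 3))) (x : (UnitAddTorus (Fin 3))) :
    Torus.convect w (fun _ : (UnitAddTorus (Fin 3)) => e) x = 0 := by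
  unfold Torus.convect Torus.fderiv Torus.liftAt
  simp

/-- Convecting along the zero field gives zero. [folklore] -/
private theorem convect_zero_left' (w : (UnitAddTorus (Fin 3)) → (EuclideanSpace ℝ (Fin 3))) (x : (UnitAddTorus (Fin 3))) :
    Torus.convect (fun _ : (UnitAddTorus (Fin 3)) => (0 : (EuclideanSpace ℝ (Fin 3)))) w x = 0 := by
  unfold Torus.convect
  simp

/-- For a smooth base, convecting along the constant field `eᵢ` is `∂ᵢ`. [folklore] -/
private theorem convect_single_left' {w : (UnitAddTorus (Fin 3)) → (EuclideanSpace ℝ (Fin 3))} (hw : Torus.IsSmooth w) (i : Fin 3) (x : (UnitAddTorus (Fin 3))) :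
    Torus.convect (fun _ : (UnitAddTorus (Fin 3)) => EuclideanSpace.single i (1 : ℝ)) w x = Torus.partialDeriv i w x := by
  unfold Torus.convect
  exact (Torus.partialDeriv_eq_fderiv_apply (hw.isContDiff (by simp)) i x).symm

/-- The Laplacian of a constant field vanishes. [folklore] -/
private theorem laplacian_const_field' (e : (EuclideanSpace ℝ (Fin 3))) (x : (UnitAddTorus (Fin 3))) :
    Torus.laplacian (fun _ : (UnitAddTorus (Fin 3)) => e) x = 0 := by
  rw [Torus.laplacian_eq_sum_partialDeriv_partialDeriv (Torus.isSmooth_const e)]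
  refine Finset.sum_eq_zero fun i _ => ?_
  have h : Torus.partialDeriv i (fun _ : (UnitAddTorus (Fin 3)) => e) = fun _ => (0 : (EuclideanSpace ℝ (Fin 3))) :=
    funext (partialDeriv_const_field' e i)
  rw [h, partialDeriv_const_field']

/-- The gradient of the zero scalar vanishes. [folklore] -/
private theorem gradient_zero_scalar' (x : (UnitAddTorus (Fin 3))) :
    Torus.gradient (fun _ : (UnitAddTorus (Fin 3)) => (0 : ℝ)) x = 0 := by
  unfold Torus.gradient Torus.liftAt
  simp [_root_.gradient]

/-- `∫⟪e, ∂ᵢ w⟫ = 0` for constant `e` and smooth periodic `w` (periodicity). [folklore] -/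
private theorem integral_inner_const_partialDeriv' {w : (UnitAddTorus (Fin 3)) → (EuclideanSpace ℝ (Fin 3))} (hw : Torus.IsSmooth w) (e : (EuclideanSpace ℝ (Fin 3)))
    (i : Fin 3) :
    MeasureTheory.integral MeasureTheory.volume
      (fun x => inner ℝ ((fun _ : (UnitAddTorus (Fin 3)) => e) x) (Torus.partialDeriv i w x)) = 0 := by
  have h := Torus.integral_inner_partialDeriv_eq_neg (Torus.isSmooth_const e) hw i
  have h0 : (fun x => inner ℝ (Torus.partialDeriv i (fun _ : (UnitAddTorus (Fin 3)) => e) x) (w x)) =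
      fun _ => (0 : ℝ) := by
    funext x
    rw [partialDeriv_const_field', inner_zero_left]
  rw [h0] at h
  simp only [integral_zero, zero_eq_neg] at h
  simpa using h

/-- **Border test `(v, r, b) = (0, 0, 1)`.** If the bordered a-priori bound (last clause of
`NeutralTaylorWaves.NonresonantTaylorWaves`, verbatim) holds at `(w, c)` with viscosity `ν` and
constant `M`, then `1 ≤ M² ∫‖∂₃w‖²`: the drift unknown `b` is controlled only through `b ∂₃w`. -/
theorem bordered_one_le {ν : ℝ} {w : (UnitAddTorus (Fin 3)) → (EuclideanSpace ℝ (Fin 3))} {c M : ℝ}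
    (h : ∀ (v : (UnitAddTorus (Fin 3)) → (EuclideanSpace ℝ (Fin 3))) (r : (UnitAddTorus (Fin 3)) → ℝ) (b : ℝ), Torus.IsSmooth v → Torus.IsSmooth r →
      Torus.IsDivFree v → Torus.HasZeroMean v →
      MeasureTheory.integral MeasureTheory.volume (fun x => ‖v x‖ ^ 2) + b ^ 2 ≤
        M ^ 2 * (MeasureTheory.integral MeasureTheory.volume (fun x =>
          ‖Torus.convect w v x + Torus.convect v w x - ν • Torus.laplacian v x +
            Torus.gradient r x - c • Torus.partialDeriv (2 : Fin 3) v x -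
            b • Torus.partialDeriv (2 : Fin 3) w x‖ ^ 2) +
          (MeasureTheory.integral MeasureTheory.volume (fun x =>
            inner ℝ (v x) (Torus.partialDeriv (2 : Fin 3) w x))) ^ 2)) :
    1 ≤ M ^ 2 * MeasureTheory.integral MeasureTheory.volume
      (fun x => ‖Torus.partialDeriv (2 : Fin 3) w x‖ ^ 2) := by
  have key := h (fun _ => 0) (fun _ => 0) 1 (Torus.isSmooth_const _) (Torus.isSmooth_const _)
    (isDivFree_const_field' 0) hasZeroMean_zero_field'
  simp only [convect_const_right', convect_zero_left', laplacian_const_field', gradient_zero_scalar',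
    partialDeriv_const_field', smul_zero, sub_zero, add_zero, zero_add, one_smul, norm_zero,
    inner_zero_left, integral_zero, zero_sub, norm_neg, one_pow,
    ne_eq, OfNat.ofNat_ne_zero, not_false_eq_true, zero_pow] at key
  simpa using key

/-- Hence an `x₃`-invariant base (`∂₃w ≡ 0`, axial number `m = 0`) NEVER carries the bordered bound:
witnesses of the crux's consequent are genuinely three-dimensional. -/
theorem bordered_false_of_planar {ν : ℝ} {w : (UnitAddTorus (Fin 3)) → (EuclideanSpace ℝ (Fin 3))} {c M : ℝ}
    (hw : ∀ x, Torus.partialDeriv (2 : Fin 3) w x = 0) :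
    ¬ (∀ (v : (UnitAddTorus (Fin 3)) → (EuclideanSpace ℝ (Fin 3))) (r : (UnitAddTorus (Fin 3)) → ℝ) (b : ℝ), Torus.IsSmooth v → Torus.IsSmooth r →
      Torus.IsDivFree v → Torus.HasZeroMean v →
      MeasureTheory.integral MeasureTheory.volume (fun x => ‖v x‖ ^ 2) + b ^ 2 ≤
        M ^ 2 * (MeasureTheory.integral MeasureTheory.volume (fun x =>
          ‖Torus.convect w v x + Torus.convect v w x - ν • Torus.laplacian v x +
            Torus.gradient r x - c • Torus.partialDeriv (2 : Fin 3) v x -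
            b • Torus.partialDeriv (2 : Fin 3) w x‖ ^ 2) +
          (MeasureTheory.integral MeasureTheory.volume (fun x =>
            inner ℝ (v x) (Torus.partialDeriv (2 : Fin 3) w x))) ^ 2)) := by
  intro h
  have h1 := bordered_one_le h
  simp only [hw, norm_zero, ne_eq, OfNat.ofNat_ne_zero, not_false_eq_true, zero_pow,
    integral_zero, mul_zero] at h1
  exact absurd h1 (by norm_num)

/-- **`_false_without_` the mean-zero test class (Galilean boost).** With `HasZeroMean v` dropped,
the bordered bound fails at EVERY smooth base `w`, drift `c`, viscosity `ν` and constant `M`: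
the triple `(v, r, b) = (e₃, 0, 1)` is an exact kernel vector of the bordered operator. -/
theorem bordered_false_without_meanZero {ν : ℝ} {w : (UnitAddTorus (Fin 3)) → (EuclideanSpace ℝ (Fin 3))} (hw : Torus.IsSmooth w) (c M : ℝ) :
    ¬ (∀ (v : (UnitAddTorus (Fin 3)) → (EuclideanSpace ℝ (Fin 3))) (r : (UnitAddTorus (Fin 3)) → ℝ) (b : ℝ), Torus.IsSmooth v → Torus.IsSmooth r →
      Torus.IsDivFree v →
      MeasureTheory.integral MeasureTheory.volume (fun x => ‖v x‖ ^ 2) + b ^ 2 ≤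
        M ^ 2 * (MeasureTheory.integral MeasureTheory.volume (fun x =>
          ‖Torus.convect w v x + Torus.convect v w x - ν • Torus.laplacian v x +
            Torus.gradient r x - c • Torus.partialDeriv (2 : Fin 3) v x -
            b • Torus.partialDeriv (2 : Fin 3) w x‖ ^ 2) +
          (MeasureTheory.integral MeasureTheory.volume (fun x =>
            inner ℝ (v x) (Torus.partialDeriv (2 : Fin 3) w x))) ^ 2)) := by
  intro h
  have key := h (fun _ => EuclideanSpace.single (2 : Fin 3) (1 : ℝ)) (fun _ => 0) 1
    (Torus.isSmooth_const _) (Torus.isSmooth_const _) (isDivFree_const_field' _)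
  rw [integral_inner_const_partialDeriv' hw] at key
  simp only [convect_const_right', convect_single_left' hw, laplacian_const_field',
    gradient_zero_scalar', partialDeriv_const_field', smul_zero, sub_zero, add_zero, zero_add,
    one_smul, sub_self, norm_zero, ne_eq, OfNat.ofNat_ne_zero, not_false_eq_true, zero_pow,
    integral_zero, mul_zero, one_pow] at key
  have hpos : 0 ≤ MeasureTheory.integral MeasureTheory.volume
      (fun x : (UnitAddTorus (Fin 3)) => ‖(fun _ : (UnitAddTorus (Fin 3)) => EuclideanSpace.single (2 : Fin 3) (1 : ℝ)) x‖ ^ 2) :=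
    integral_nonneg fun _ => by positivity
  linarith

end Summit.AnomalousDissipation.AnomalousDissipation.Theorems.NonresonantSelection.Negative

end
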